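import Summits.CriticalPhenomena.SAWScalingLimit.Theorems.SAWLoopFugacityFlowSimpleSubseqLimitsFarReturnLine
import HarnessLib

/-!
# `PastFutureAvoidance` is PINNED: the first-entrance slit-avoidance statement is equivalent to the
# ORDER half of the crux `SimpleSubseqLimits` modulo tightness
(crux stmt-CriticalPhenomena-4982, decl `Summit.CriticalPhenomena.SAWScalingLimit.Theses.SAWLoopFugacityFlow.SimpleSubseqLimits`;
line `past-shadowing-costs-halves`, reshaping v4; line lead c4, 2026-08-17)

`FarPast.Line.PastFutureAvoidance` (this seat) is the polyline-level statement "with probability `≤ θ`,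
eventually in `δ`, the critical SAW has a past/future return at its FIRST ENTRANCE into `B̄(q, r')`:
the future after the entrance comes `ε`-close to a value taken while the walk was outside the guard ball
`B̄(q, 5r)`" — the event the exact domain Markov property turns into "the critical SAW of the slit graph
avoids the far part of the slit". `FarPast.Line.farReturnDecay_of_pastFutureAvoidance` showed it is
SUFFICIENT for the ORDER input `FarReturnDecay`. This file shows it is also NECESSARY given tightness, and
summit-implied, so that

  `crux_iff_pastFuture : EventualTight → (SimpleSubseqLimits ↔ PastFutureAvoidance ∧ BoundaryDecay)`

— the residual of the crux in its cleanest form: BOUNDARY AVOIDANCE, TWICE (the domain boundary; the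
own past at first entrances), both lattice statements, no route item.

Proof of necessity: the necessity principle (`Negative.exists_limsup_law_le_of_crux_of_not_simple`,
p84995/p131674 lineage) applied to the closed antitone thickenings
`F n = closure (mk '' {γ | PastFutureReturn γ q r (2r) (1/(n+1))})`; the core
(`not_mem_simple_of_forall_mem_closure`): a SIMPLE class lies in no such intersection — sup-close
representatives `γₙ` of an injective `e` carry `vₙ < τₙ ≤ t'ₙ` with `5r < dist (γₙ vₙ) q`,
`dist (γₙ τₙ) q ≤ r'`, `dist (γₙ t'ₙ) (γₙ vₙ) < 1/(n+1)`; along a subsequence the times converge to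
`v₁ ≤ τ₁ ≤ t₁` with `e t₁ = e v₁`, so `t₁ = v₁ = τ₁` by injectivity, and `5r ≤ dist (e v₁) q =
dist (e τ₁) q ≤ r' < 5r`. (The first-hit clause of `τₙ` is not even needed.)

Results (namespace `…Theorems.SimpleSubseqLimits.FarPast.Pinned`): `pastFutureReturn_reparam`,
`pastFutureReturn_mono`, `not_mem_simple_of_forall_mem_closure`, `pastFutureAvoidance_of_principle`,
`pastFutureAvoidance_of_crux`, `pastFutureAvoidance_of_sawScalingLimit`, `crux_iff_pastFuture`,
`pastFuture_iff_farReturn` (the two ORDER typings agree modulo tightness + boundary decay is not needed: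
`EventualTight → (PastFutureAvoidance ↔ FarReturnDecay)` given … see the statement), and the registered
form `stub_pastFuturePinned`.
-/

noncomputable section

open MeasureTheory Filter Topology Set Metric Function
open Literature.Probability.RandomPlanarGeometry Literature.Probability.RandomPlanarGeometry.SAW
open Literature.Probability.LatticeModels
open scoped ENNReal NNReal BoundedContinuousFunction unitInterval

namespace Summit.CriticalPhenomena.SAWScalingLimit.Theorems.SimpleSubseqLimits.FarPast.Pinned

open Summit.CriticalPhenomena.SAWScalingLimit.Theses.SAWLoopFugacityFlow (SimpleSubseqLimits EventualTight)
open Summit.CriticalPhenomena.SAWScalingLimit.Theorems.SimpleSubseqLimits.Negative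
  (exists_limsup_law_le_of_sawScalingLimit_of_not_simple exists_limsup_law_le_of_crux_of_not_simple)
open Summit.CriticalPhenomena.SAWScalingLimit.Theorems.SimpleSubseqLimits.MarkedPointRevisit.Passage
  (latticeCurve mk_latticeCurve)
open Summit.CriticalPhenomena.SAWScalingLimit.Theorems.SimpleSubseqLimits.Boundary.Passage (BoundaryDecay)
open Summit.CriticalPhenomena.SAWScalingLimit.Theorems.SimpleSubseqLimits.Boundary.Line (boundaryDecay_of_crux)
open Summit.CriticalPhenomena.SAWScalingLimit.Theorems.SimpleSubseqLimits.FarPast.Passage (FarReturnDecay)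
open Summit.CriticalPhenomena.SAWScalingLimit.Theorems.SimpleSubseqLimits.FarPast.Line
  (PastFutureReturn PastFutureAvoidanceAt PastFutureAvoidance line_farReturn
    farReturnDecay_of_pastFutureAvoidance simpleSubseqLimits_of_pastFutureAvoidance)

variable {D : DobrushinDomain} {a b : ℝ → Site 2}

/-! ### Invariance and monotonicity of the past/future return configuration -/

/-- Past/future returns are invariant under increasing reparametrisation (first hitting times and
initial pieces are order notions; witnesses `φ.symm v, φ.symm τ, φ.symm t'`). [folklore] -/
theorem pastFutureReturn_reparam {γ : Curve ℂ} {q : ℂ} {r r' ε : ℝ}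
    (h : PastFutureReturn γ q r r' ε) (φ : I ≃o I) :
    PastFutureReturn (γ.reparam φ) q r r' ε := by
  obtain ⟨v, τ, t', hvτ, hτt, hτ, hfirst, hguard, hret⟩ := h
  refine ⟨φ.symm v, φ.symm τ, φ.symm t', φ.symm.strictMono hvτ, φ.symm.monotone hτt, ?_, ?_, ?_, ?_⟩
  · show γ (φ (φ.symm τ)) ∈ closedBall q r'
    rw [φ.apply_symm_apply]; exact hτ
  · intro u hu
    have h1 : φ u < τ := by simpa using φ.strictMono hu
    show γ (φ u) ∉ closedBall q r'
    exact hfirst (φ u) h1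
  · intro u hu
    have h1 : φ u ≤ v := by simpa using φ.monotone hu
    show 5 * r < dist (γ (φ u)) q
    exact hguard (φ u) h1
  · show dist (γ (φ (φ.symm t'))) (γ (φ (φ.symm v))) < ε
    rw [φ.apply_symm_apply, φ.apply_symm_apply]; exact hret

/-- Past/future returns are monotone in the width `ε`. [folklore] -/
theorem pastFutureReturn_mono {γ : Curve ℂ} {q : ℂ} {r r' ε ε' : ℝ}
    (h : PastFutureReturn γ q r r' ε) (hε : ε ≤ ε') : PastFutureReturn γ q r r' ε' := by
  obtain ⟨v, τ, t', hvτ, hτt, hτ, hfirst, hguard, hret⟩ := h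
  exact ⟨v, τ, t', hvτ, hτt, hτ, hfirst, hguard, hret.trans_le hε⟩

/-! ### The core: no simple class in the intersection of the closed thickenings -/

/-- **Core.** If `r' < 5r`, a SIMPLE class cannot lie in
`closure (mk '' {γ | PastFutureReturn γ q r r' (1/(n+1))})` for every `n`: sup-close representatives
`γₙ` of the injective `e` carry `vₙ < τₙ ≤ t'ₙ` with `5r < dist (γₙ vₙ) q`, `dist (γₙ τₙ) q ≤ r'`,
`dist (γₙ t'ₙ) (γₙ vₙ) < 1/(n+1)`; along a subsequence the times converge to `v₁ ≤ τ₁ ≤ t₁` with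
`e t₁ = e v₁`, hence `t₁ = v₁ = τ₁`, and `5r ≤ dist (e v₁) q = dist (e τ₁) q ≤ r'`. [folklore] -/
theorem not_mem_simple_of_forall_mem_closure {q : ℂ} {r r' : ℝ} (h5 : r' < 5 * r)
    {c : CurveClass ℂ} (hc : c ∈ CurveClass.simple)
    (h : ∀ n : ℕ, c ∈ closure
      (CurveClass.mk '' {γ : Curve ℂ | PastFutureReturn γ q r r' (1 / ((n : ℝ) + 1))})) : False := by
  obtain ⟨e, he, rfl⟩ := hc
  have hex : ∀ n : ℕ, ∃ γ : Curve ℂ, PastFutureReturn γ q r r' (1 / ((n : ℝ) + 1)) ∧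
      ∀ t, dist (e t) (γ t) < 1 / ((n : ℝ) + 1) := by
    intro n
    obtain ⟨b, hb, hd⟩ :=
      Metric.mem_closure_iff.1 (h n) _ (by positivity : (0 : ℝ) < 1 / ((n : ℝ) + 1))
    obtain ⟨γ, hγ, rfl⟩ := hb
    change dist (SeparationQuotient.mk e) (SeparationQuotient.mk γ) < _ at hd
    rw [SeparationQuotient.dist_mk] at hd
    obtain ⟨φ, hφ⟩ := Curve.exists_dist_reparam_lt hd
    exact ⟨γ.reparam φ, pastFutureReturn_reparam hγ φ,
      fun t => (ContinuousMap.dist_apply_le_dist t).trans_lt hφ⟩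
  choose γ hγ hclose using hex
  choose v τ t' hvτ hτt hτ _hfirst hguard hret using hγ
  obtain ⟨⟨v₁, τ₁, t₁⟩, ψ, hψ, hlim⟩ :=
    CompactSpace.tendsto_subseq (fun n => (v n, τ n, t' n))
  have hvl : Tendsto (fun k => v (ψ k)) atTop (𝓝 v₁) :=
    (continuous_fst.tendsto _).comp hlim
  have hτl : Tendsto (fun k => τ (ψ k)) atTop (𝓝 τ₁) :=
    (continuous_fst.comp continuous_snd).tendsto _ |>.comp hlim
  have htl : Tendsto (fun k => t' (ψ k)) atTop (𝓝 t₁) :=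
    (continuous_snd.comp continuous_snd).tendsto _ |>.comp hlim
  have herr : Tendsto (fun k : ℕ => 1 / ((ψ k : ℝ) + 1)) atTop (𝓝 0) := by
    have h1 : Tendsto (fun k : ℕ => 1 / ((k : ℝ) + 1)) atTop (𝓝 0) :=
      tendsto_one_div_add_atTop_nhds_zero_nat
    refine squeeze_zero (fun k => by positivity) (fun k => ?_) h1
    have : (k : ℝ) ≤ ψ k := by exact_mod_cast hψ.id_le k
    exact one_div_le_one_div_of_le (by positivity) (by linarith)
  have hval : ∀ {u : ℕ → I} {u₀ : I}, Tendsto (fun k => u (ψ k)) atTop (𝓝 u₀) →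
      Tendsto (fun k => γ (ψ k) (u (ψ k))) atTop (𝓝 (e u₀)) := by
    intro u u₀ hu
    rw [tendsto_iff_dist_tendsto_zero]
    have h2 : Tendsto (fun k => dist (e (u (ψ k))) (e u₀)) atTop (𝓝 0) := by
      rw [← tendsto_iff_dist_tendsto_zero]
      exact (e.continuous.tendsto u₀).comp hu
    refine squeeze_zero (fun k => dist_nonneg) (fun k => ?_)
      (by simpa only [add_zero] using herr.add h2)
    calc dist (γ (ψ k) (u (ψ k))) (e u₀)
        ≤ dist (γ (ψ k) (u (ψ k))) (e (u (ψ k))) + dist (e (u (ψ k))) (e u₀) := dist_triangle _ _ _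
      _ ≤ 1 / ((ψ k : ℝ) + 1) + dist (e (u (ψ k))) (e u₀) := by
          gcongr; rw [dist_comm]; exact (hclose (ψ k) _).le
  have hvv := hval hvl
  have hvτ' := hval hτl
  have hvt := hval htl
  -- limits of the three metric clauses
  have hguard' : 5 * r ≤ dist (e v₁) q :=
    ge_of_tendsto' (hvv.dist tendsto_const_nhds) fun k => (hguard (ψ k) (v (ψ k)) le_rfl).le
  have hball' : dist (e τ₁) q ≤ r' :=
    le_of_tendsto' (hvτ'.dist tendsto_const_nhds) fun k => mem_closedBall.1 (hτ (ψ k))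
  have heq : e t₁ = e v₁ := by
    have hh1 : Tendsto (fun k => dist (γ (ψ k) (t' (ψ k))) (γ (ψ k) (v (ψ k)))) atTop
        (𝓝 (dist (e t₁) (e v₁))) := hvt.dist hvv
    have hh2 : Tendsto (fun k => dist (γ (ψ k) (t' (ψ k))) (γ (ψ k) (v (ψ k)))) atTop (𝓝 0) :=
      squeeze_zero (fun k => dist_nonneg) (fun k => (hret (ψ k)).le) herr
    exact dist_eq_zero.1 (tendsto_nhds_unique hh1 hh2)
  have h1 : v₁ ≤ τ₁ := le_of_tendsto_of_tendsto' hvl hτl fun k => (hvτ (ψ k)).le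
  have h2 : τ₁ ≤ t₁ := le_of_tendsto_of_tendsto' hτl htl fun k => hτt (ψ k)
  have h3 : t₁ = v₁ := he heq
  have h4 : τ₁ = v₁ := le_antisymm (h3 ▸ h2) h1
  rw [h4] at hball'
  linarith

/-- The closed `1/(n+1)`-thickenings `n ↦ closure (mk '' {γ | PastFutureReturn γ q r r' (1/(n+1))})`
decrease in `n`. [folklore] -/
theorem antitone_thick (q : ℂ) (r r' : ℝ) :
    Antitone fun n : ℕ =>
      closure (CurveClass.mk '' {γ : Curve ℂ | PastFutureReturn γ q r r' (1 / ((n : ℝ) + 1))}) := by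
  intro m n hmn
  have hmn' : (m : ℝ) ≤ n := by exact_mod_cast hmn
  have hle : 1 / ((n : ℝ) + 1) ≤ 1 / ((m : ℝ) + 1) :=
    one_div_le_one_div_of_le (by positivity) (by linarith)
  refine closure_mono ?_
  rintro c ⟨γ, hγ, rfl⟩
  exact ⟨γ, pastFutureReturn_mono hγ hle, rfl⟩

/-- The intersection of the closed thickenings contains no simple class (`r' < 5r`). [folklore] -/
theorem thick_core {q : ℂ} {r r' : ℝ} (h5 : r' < 5 * r) (c : CurveClass ℂ)
    (hc : ∀ n : ℕ, c ∈
      closure (CurveClass.mk '' {γ : Curve ℂ | PastFutureReturn γ q r r' (1 / ((n : ℝ) + 1))})) :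
    c ∉ CurveClass.simple := fun hs =>
  not_mem_simple_of_forall_mem_closure h5 hs hc

/-! ### The pins -/

/-- **`PastFutureAvoidance` from any necessity principle for closed antitone thickenings with
simple-free core**: at `(q, r, θ)` take `r' = 2r` and the thickenings above; the principle gives `n`
with `limsup_δ P_δ[curve ∈ thick n] ≤ θ/2 < θ`; the polyline event at width `1/(n+1)` is contained in
`{curve ∈ thick n}` (`mk (latticeCurve γ) = γ.curve`), hence eventually `≤ θ`. [folklore] -/
theorem pastFutureAvoidance_of_principle
    (Hp : ∀ (D : DobrushinDomain) (a b : ℝ → Site 2), IsEndpointApprox D a b →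
      ∀ {F : ℕ → Set (CurveClass ℂ)}, (∀ n, IsClosed (F n)) → Antitone F →
        (∀ c : CurveClass ℂ, (∀ n, c ∈ F n) → c ∉ CurveClass.simple) → ∀ {θ : ℝ≥0∞}, 0 < θ →
          ∃ n, limsup (fun δ => law D.carrier δ (a δ) (b δ) {γ | γ.curve ∈ F n}) (𝓝[>] (0 : ℝ)) ≤ θ) :
    PastFutureAvoidance := by
  intro D a b hab q r θ hr hθ
  have hθ' : (0 : ℝ≥0∞) < ENNReal.ofReal θ / 2 :=
    ENNReal.half_pos (ENNReal.ofReal_pos.2 hθ).ne'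
  have h5 : 2 * r < 5 * r := by linarith
  obtain ⟨n, hn⟩ := Hp D a b hab
    (F := fun n : ℕ => closure (CurveClass.mk ''
      {γ : Curve ℂ | PastFutureReturn γ q r (2 * r) (1 / ((n : ℝ) + 1))}))
    (fun _ => isClosed_closure) (antitone_thick q r (2 * r)) (thick_core h5) hθ'
  refine ⟨1 / ((n : ℝ) + 1), 2 * r, by positivity, by linarith, by linarith, ?_⟩
  have hle : limsup (fun δ => law D.carrier δ (a δ) (b δ)
      {γ | PastFutureReturn (latticeCurve γ) q r (2 * r) (1 / ((n : ℝ) + 1))}) (𝓝[>] (0 : ℝ)) ≤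
        ENNReal.ofReal θ / 2 := by
    refine le_trans (Filter.limsup_le_limsup (Eventually.of_forall fun δ => ?_)) hn
    refine measure_mono fun γ hγ => subset_closure ?_
    exact ⟨latticeCurve γ, hγ, mk_latticeCurve γ⟩
  have hlt : limsup (fun δ => law D.carrier δ (a δ) (b δ)
      {γ | PastFutureReturn (latticeCurve γ) q r (2 * r) (1 / ((n : ℝ) + 1))}) (𝓝[>] (0 : ℝ)) <
        ENNReal.ofReal θ :=
    hle.trans_lt (ENNReal.half_lt_self (ENNReal.ofReal_pos.2 hθ).ne' ENNReal.ofReal_ne_top)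
  filter_upwards [Filter.eventually_lt_of_limsup_lt hlt] with δ hδ using hδ.le

/-- **`PastFutureAvoidance` is NECESSARY for the crux given `EventualTight`.** [folklore] -/
theorem pastFutureAvoidance_of_crux (hT : EventualTight) (hS : SimpleSubseqLimits) : PastFutureAvoidance :=
  pastFutureAvoidance_of_principle fun _ _ _ hab _ hF hanti hcore _ hθ =>
    exists_limsup_law_le_of_crux_of_not_simple hT hS hab hF hanti hcore hθ

/-- **`PastFutureAvoidance` is implied by the summit conjecture** `SAWScalingLimit` (not over-strong).
[folklore] -/
theorem pastFutureAvoidance_of_sawScalingLimit (h : _root_.SAWScalingLimit) : PastFutureAvoidance :=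
  pastFutureAvoidance_of_principle fun _ _ _ hab _ hF hanti hcore _ hθ =>
    exists_limsup_law_le_of_sawScalingLimit_of_not_simple h hab hF hanti hcore hθ

/-- **THE RESIDUAL OF THE CRUX, CLEANEST FORM.** Under `EventualTight` (stmt-1372) the crux IS
"boundary avoidance, twice": `SimpleSubseqLimits ↔ PastFutureAvoidance ∧ BoundaryDecay` — the critical SAW
avoids its own far past at first entrances (a past/future event at one stopping time, domain-Markov
equivalent to slit-boundary avoidance) and avoids `∂Ω` away from the marked points. No route item.
[folklore] -/
theorem crux_iff_pastFuture (hT : EventualTight) :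
    SimpleSubseqLimits ↔ PastFutureAvoidance ∧ BoundaryDecay :=
  ⟨fun hS => ⟨pastFutureAvoidance_of_crux hT hS, boundaryDecay_of_crux hT hS⟩,
    fun h => simpleSubseqLimits_of_pastFutureAvoidance h.1 h.2⟩

/-- The two ORDER typings of v4 agree modulo tightness and the boundary input:
`PastFutureAvoidance → FarReturnDecay` always, and `FarReturnDecay → PastFutureAvoidance` under
`EventualTight ∧ BoundaryDecay` (through the crux). [folklore] -/
theorem pastFuture_iff_farReturn (hT : EventualTight) (hB : BoundaryDecay) :
    PastFutureAvoidance ↔ FarReturnDecay :=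
  ⟨farReturnDecay_of_pastFutureAvoidance,
    fun hF => pastFutureAvoidance_of_crux hT (line_farReturn hF hB)⟩

/-- Both v4 inputs, cleanest form, are implied by the summit conjecture. [folklore] -/
theorem pastFuture_of_sawScalingLimit (h : _root_.SAWScalingLimit) : PastFutureAvoidance ∧ BoundaryDecay :=
  ⟨pastFutureAvoidance_of_sawScalingLimit h,
    Summit.CriticalPhenomena.SAWScalingLimit.Theorems.SimpleSubseqLimits.Boundary.Line.boundaryDecay_of_sawScalingLimit h⟩

/-! ### The promotable item, cleanest form, self-contained (Literature vocabulary only) -/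

/-- **BOUNDARY AVOIDANCE, TWICE — cleanest self-contained form of the crux's residual**
(`PastFutureAvoidance ∧ BoundaryDecay` with all Theorems-level vocabulary INLINED, so that it elaborates
in a route file): (i) for every ball `B̄(q, r)` and target `θ` there are `ε > 0` and `r' ∈ (r, 5r]` such
that, eventually as `δ → 0⁺`, with probability `≤ θ` the lattice polyline `γ` of the critical SAW has
times `v < τ ≤ t'` with `τ` the FIRST hitting time of `B̄(q, r')`, `γ [0, v]` outside the guard ball
`B̄(q, 5r)`, and `dist (γ t') (γ v) < ε` — by exact domain Markov: the critical SAW of the slit graph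
`Ω_δ ∖ γ[0, τ)` from the tip comes `ε`-close to the far part of the slit; (ii) for every `ρ, θ` there is
`ε` such that, eventually, with probability `≤ θ` the walk's curve class visits the open
`ε`-neighbourhood of `∂Ω` at a point `ρ`-far from both marked points. Equivalent to the crux modulo
`EventualTight` (`crux_iff_slitAvoidanceItem`), implied by the summit conjecture; an open statement of
this crux (the form recommended for promotion) — deliberately untagged: not a literature fact. -/
def SlitAvoidanceItem : Prop :=
  (∀ (D : DobrushinDomain) (a b : ℝ → Site 2), SAW.IsEndpointApprox D a b →
    ∀ (q : ℂ) (r θ : ℝ), 0 < r → 0 < θ → ∃ ε r' : ℝ, 0 < ε ∧ r < r' ∧ r' ≤ 5 * r ∧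
      ∀ᶠ δ in 𝓝[>] (0 : ℝ),
        SAW.law D.carrier δ (a δ) (b δ) {γ |
          ∃ v τ t' : I, v < τ ∧ τ ≤ t' ∧
            (⟨γ.walk.toCurve (meshPoint δ)⟩ : Curve ℂ) τ ∈ closedBall q r' ∧
            (∀ u : I, u < τ → (⟨γ.walk.toCurve (meshPoint δ)⟩ : Curve ℂ) u ∉ closedBall q r') ∧
            (∀ u : I, u ≤ v → 5 * r < dist ((⟨γ.walk.toCurve (meshPoint δ)⟩ : Curve ℂ) u) q) ∧
            dist ((⟨γ.walk.toCurve (meshPoint δ)⟩ : Curve ℂ) t')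
              ((⟨γ.walk.toCurve (meshPoint δ)⟩ : Curve ℂ) v) < ε} ≤ ENNReal.ofReal θ) ∧
  (∀ (D : DobrushinDomain) (a b : ℝ → Site 2), SAW.IsEndpointApprox D a b →
    ∀ ρ θ : ℝ, 0 < ρ → 0 < θ → ∃ ε : ℝ, 0 < ε ∧
      ∀ᶠ δ in 𝓝[>] (0 : ℝ),
        SAW.law D.carrier δ (a δ) (b δ) {γ | ∃ γ' : Curve ℂ, CurveClass.mk γ' = γ.curve ∧
          ∃ t : I, infDist (γ' t) (frontier D.carrier) < ε ∧ ρ < dist (γ' t) (D.pt 0) ∧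
            ρ < dist (γ' t) (D.pt 1)} ≤ ENNReal.ofReal θ)

/-- The self-contained statement IS `PastFutureAvoidance ∧ BoundaryDecay` (definitional). [folklore] -/
theorem slitAvoidanceItem_iff : SlitAvoidanceItem ↔ PastFutureAvoidance ∧ BoundaryDecay := Iff.rfl

/-- **Glue for the promoted item (cleanest form)**: it proves the crux. [folklore] -/
theorem simpleSubseqLimits_of_slitAvoidanceItem (h : SlitAvoidanceItem) : SimpleSubseqLimits :=
  simpleSubseqLimits_of_pastFutureAvoidance (slitAvoidanceItem_iff.1 h).1 (slitAvoidanceItem_iff.1 h).2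

/-- … is equivalent to it modulo `EventualTight` … [folklore] -/
theorem crux_iff_slitAvoidanceItem (hT : EventualTight) : SimpleSubseqLimits ↔ SlitAvoidanceItem :=
  (crux_iff_pastFuture hT).trans slitAvoidanceItem_iff.symm

/-- … and implied by the summit conjecture. [folklore] -/
theorem slitAvoidanceItem_of_sawScalingLimit (h : _root_.SAWScalingLimit) : SlitAvoidanceItem :=
  slitAvoidanceItem_iff.2 (pastFuture_of_sawScalingLimit h)

/-- **Registered form (stub `stub_pastFuturePinned` of the crux item stmt-CriticalPhenomena-4982).**
The residual certificate of the v4 line in its cleanest form. [folklore] -/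
theorem stub_pastFuturePinned : EventualTight → (SimpleSubseqLimits ↔ PastFutureAvoidance ∧ BoundaryDecay) :=
  crux_iff_pastFuture

end Summit.CriticalPhenomena.SAWScalingLimit.Theorems.SimpleSubseqLimits.FarPast.Pinned

end
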